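/-
Copyright (c) 2026 the pub-hodgecm-mathlib formalisation cell (harness21).  Prover seat hodgecm-mathlib-K2E3-p21 (g4), Track B «K2-LIT» ∕ h413
(`stmt-HodgeConjecture-24833`), line `K2_E3_EllipticInputs`, unit U12 §L, kernel road «RICHARDSON» for (L-B_GL) at `N = 3` (road owner K2E3-p11 (g4), deal
2026-09-04T04:32Z «Λ_E PACKAGING»), brick (R2-pack), part 1: THE RICHARDSON MEASURE OF A TWO-BLOCK PARABOLIC AS AN `Ad`-INVARIANT RADON MEASURE ON `𝔤𝔩_n(F)`.
2026-09-04.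
-/
import Summits.HodgeConjecture.HodgeConjecture.Theorems.K2E3GLnRichardsonLieMeasureAdInvariant   -- ★ p857353 (K2E3-p11 g4): `GLn.nilpotentAverage_comp_conj_eq`
import Literature.NumberTheory.Automorphic.GLnLeviQuotientIwasawaIntegration                      -- ★ `exists_boxHomeomorph_unipotentRadicalGL` (box chart of `U_c`)
import Literature.NumberTheory.Rogawski1990.LocalTransferFundamentalLemma                        -- ★ `isLocSmooth_indicator`
import Literature.Topology.LocallyConstantExtend                                                 -- ★ compact-open basis lemmas
import Literature.NumberTheory.Automorphic.TateLocalZetaShells                                   -- ★ `secondCountableTopology_localField`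
import Literature.NumberTheory.Weil1964.GLnRestrictedProductHaar                                    -- ★ `secondCountableTopology_generalLinearGroup`
import Literature.NumberTheory.GaloisRepresentations.LocalReciprocityThetaProofs                 -- ★ `totallyDisconnectedSpace_of_isNonarchimedeanLocalField`
import Mathlib.MeasureTheory.Measure.Regular
import HarnessLib

/-!
# K2_E3 road (h413), §L — kernel road «RICHARDSON» for (L-B_GL) at `N = 3`, brick (R2-pack) part 1: the Richardson measure
# `Λ_c = ((k, u) ↦ k (u − 1) k⁻¹)_* (κ ⊗ μ_U)` of a two-block parabolic `P_c ≤ GL_n(F)` is a NON-ZERO `Ad(GL_n(F))`-INVARIANT RADON MEASURE on `𝔤𝔩_n(F)`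

Cell `pub/hodgecm-mathlib` (D-0151), Track B, seat K2E3-p21 (g4); road owner K2E3-p11 (g4) (MEMO «ROW 11 — SPLIT ROAD» v1 §4 «RICHARDSON»; 2026-09-04T04:32Z «the
packaging lemma `Λ.map (Ad g) = Λ` + `Λ (orbit E)ᶜ = 0` + `Λ ≠ 0`, finite on compacts»), §L lead K2E3-p12 (g4), dealer K2E3-plan (g3).
`--supports stmt-HodgeConjecture-24833 --as helper`; THEOREMS ONLY (no definition ∕ instance ∕ notation ∕ named fact ∕ `sorry`); never imports `Cruxes/…/Lines`.
COUNT-NEUTRAL ((L-B_GL) ∕ (LBGL-ge3) stay OPEN).  Part 2 (`n = 3`, the minimal orbit `Ad·E₁₃`): `K2E3GL3MinimalRichardsonMeasure`.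

Throughout `ρ := κ.prod μN` on `GL_n(𝒪) × U_c` (`κ`, `μ_U = μN` Haar), `φ(k, u) := k (u − 1) k⁻¹ ∈ 𝔤𝔩_n(F)` and `Λ_c := ρ.map φ` (written out in full; no definitions).
* §1 **A RADON MEASURE ON A LOCALLY COMPACT TOTALLY DISCONNECTED SECOND-COUNTABLE SPACE IS DETERMINED BY ITS VALUES ON COMPACT-OPEN SETS**
  (`Measure.ext_of_forall_isCompact_isOpen`; compact opens are a π-system and a basis, ★ `Literature.Topology.exists_isCompact_isOpen_mem_subset`).
* §2 (any `n`, any labelling `c`) `φ` is continuous and measurable; a Haar measure on `U_c` is s-finite and, if the box `I × J` is non-empty, has `μ_U {1} = 0`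
  (`U_c ≅ F^{I×J}` ★ box chart is not discrete; Mathlib `IsHaarMeasure.nullSingletonClass`); **`Λ_c` is finite on compact sets** (`φ⁻¹(C) ⊆ K × Φ(L(Ad(K)⁻¹ C))`
  with the box chart `Φ` and the entry-reading map `L`); `Λ_c ≠ 0`; for a monotone `c`, **`Λ_c` is `Ad`-invariant AS A MEASURE** (`map_conj_map_richardson_eq`:
  ★ p857353's distribution identity on the indicators of compact-open sets + §1).
[HarishChandra1999AdmissibleDistributions, §3 pp. 8–10 (after Deligne–Ranga Rao)]; [RangaRao1972]; [BernsteinZelevinsky1976, §1.18]; [BernsteinZelevinsky1977, §2.1].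

HONEST LABEL: HC_CM is proved only modulo the 7 printed citations (2 remaining named inputs: hLiu418 = stmt-HodgeConjecture-24832, h413 = stmt-HodgeConjecture-24833)
until rung 0 closes; count-neutral helper.

References: [HarishChandra1999AdmissibleDistributions] Harish-Chandra (DeBacker–Sally), AMS ULECT 16 (1999), §3 pp. 8–10 · [RangaRao1972] R. Ranga Rao, Ann. of
Math. 96 (1972) 505–510 · [BernsteinZelevinsky1976] Russian Math. Surveys 31:3 (1976), §1.18 · [BernsteinZelevinsky1977] Ann. Sci. ÉNS 10 (1977), §2.1.
-/

set_option autoImplicit false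
set_option linter.dupNamespace false   -- `Summit.HodgeConjecture.HodgeConjecture.…` (D-0017 nested layout; lakefile exemption for Summits)

noncomputable section

open MeasureTheory Measure Filter Topology TopologicalSpace Set
open scoped MatrixGroups NNReal ENNReal
open Literature.NumberTheory.Rogawski1990 Literature.NumberTheory.Automorphic
open Literature.NumberTheory.GaloisRepresentations Literature.NumberTheory.GaloisRepresentations.IsNonarchimedeanLocalField
open Summit.HodgeConjecture.HodgeConjecture.Cruxes.H413.K2E3GLnRichardsonLieMeasureAdInvariant

namespace Summit.HodgeConjecture.HodgeConjecture.Cruxes.H413.K2E3GLnRichardsonMeasureRadon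

/-! ## §1  Radon measures on an `ℓ`-space are determined by the compact-open sets -/

/-- **Two measures on a locally compact, Hausdorff, totally disconnected, second-countable space that agree on all COMPACT OPEN sets are equal, provided the
first is finite on compact sets** (compact opens form a π-system and a basis, hence generate the Borel σ-algebra; a compact exhaustion refines to compact opens).
[cite: BernsteinZelevinsky1976, §1.1] -/
theorem Measure.ext_of_forall_isCompact_isOpen {X : Type*} [TopologicalSpace X] [LocallyCompactSpace X] [T2Space X] [TotallyDisconnectedSpace X]
    [SecondCountableTopology X] [MeasurableSpace X] [BorelSpace X] {μ ν : Measure X} [IsFiniteMeasureOnCompacts μ]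
    (h : ∀ U : Set X, IsCompact U → IsOpen U → μ U = ν U) : μ = ν := by
  have hB : IsTopologicalBasis {U : Set X | IsCompact U ∧ IsOpen U} :=
    isTopologicalBasis_of_isOpen_of_nhds (fun U hU => hU.2) fun x U hx hU => by
      obtain ⟨V, hVc, hVo, hxV, hVU⟩ := Literature.Topology.exists_isCompact_isOpen_mem_subset hU hx
      exact ⟨V, ⟨hVc, hVo⟩, hxV, hVU⟩
  choose B hB' using fun k : ℕ =>
    Literature.Topology.exists_isCompact_isOpen_superset_subset (isCompact_compactCovering X k) isOpen_univ (Set.subset_univ _)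
  refine Measure.ext_of_generateFrom_of_iUnion {U : Set X | IsCompact U ∧ IsOpen U} B (BorelSpace.measurable_eq.trans hB.borel_eq_generateFrom)
    (fun s hs t ht _ => ⟨hs.1.inter_right ht.1.isClosed, hs.2.inter ht.2⟩) ?_ (fun k => ⟨(hB' k).1, (hB' k).2.1⟩)
    (fun k => ((hB' k).1.measure_lt_top).ne) fun U hU => h U hU.1 hU.2
  exact Set.eq_univ_of_univ_subset ((iUnion_compactCovering X).symm.subset.trans (Set.iUnion_mono fun k => (hB' k).2.2.1))

/-! ## §2  The Richardson measure `Λ_c = φ_* (κ ⊗ μ_U)` of a two-block parabolic of `GL_n(F)` -/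

section General

variable {F : Type*} [Field F] [ValuativeRel F] [TopologicalSpace F] [IsNonarchimedeanLocalField F] {n : ℕ} {c : Fin n → Bool}

omit [IsNonarchimedeanLocalField F] in
/-- The Richardson map `φ(k, u) = k (u − 1) k⁻¹ : GL_n(𝒪) × U_c → 𝔤𝔩_n(F)` is continuous. [cite: HarishChandra1999AdmissibleDistributions, §3 p. 9] -/
theorem continuous_richardsonMap [IsTopologicalRing F] :
    Continuous fun q : ↥(glInt n F) × ↥(unipotentRadicalGL F c) =>
      (((q.1 : GL (Fin n) F)) : Matrix (Fin n) (Fin n) F) * ((((q.2 : GL (Fin n) F)) : Matrix (Fin n) (Fin n) F) - 1) *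
        ((((q.1 : GL (Fin n) F))⁻¹ : GL (Fin n) F) : Matrix (Fin n) (Fin n) F) := by
  have h1 : Continuous fun q : ↥(glInt n F) × ↥(unipotentRadicalGL F c) => (((q.1 : GL (Fin n) F)) : Matrix (Fin n) (Fin n) F) :=
    Units.continuous_val.comp (continuous_subtype_val.comp continuous_fst)
  have h2 : Continuous fun q : ↥(glInt n F) × ↥(unipotentRadicalGL F c) => (((q.2 : GL (Fin n) F)) : Matrix (Fin n) (Fin n) F) :=
    Units.continuous_val.comp (continuous_subtype_val.comp continuous_snd)
  have h3 : Continuous fun q : ↥(glInt n F) × ↥(unipotentRadicalGL F c) => ((((q.1 : GL (Fin n) F))⁻¹ : GL (Fin n) F) : Matrix (Fin n) (Fin n) F) :=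
    Units.continuous_coe_inv.comp (continuous_subtype_val.comp continuous_fst)
  exact (h1.mul (h2.sub continuous_const)).mul h3

/-- **`U_c(F)` is not discrete when the box `I × J` is non-empty** (`U_c ≅ F^{I×J}` by the box chart ★, and `F` is a non-discrete field), so `𝓝[≠] 1 ≠ ⊥`.
[cite: BernsteinZelevinsky1977, §2.1] -/
theorem nhdsWithin_ne_one_neBot_unipotentRadicalGL (hIJ : ∃ i j : Fin n, c i = false ∧ c j = true) :
    (𝓝[≠] (1 : ↥(unipotentRadicalGL F c))).NeBot := by
  classical
  haveI : T2Space F := (isLocalField F).toT2Space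
  obtain ⟨i₀, j₀, hi₀, hj₀⟩ := hIJ
  obtain ⟨Φ, -, hadd⟩ := exists_boxHomeomorph_unipotentRadicalGL (R := F) c
  have hΦ0 : Φ 0 = 1 := by
    have h := hadd 0 0
    rw [add_zero] at h
    exact left_eq_mul.mp h
  refine ⟨fun hbot => (isLocalField F).not_discrete ?_⟩
  -- `{1}` open in `U_c` ⇒ `{0}` open in `F^{I×J}` ⇒ `{0}` open in `F`
  have h1 : IsOpen ({1} : Set ↥(unipotentRadicalGL F c)) := (isOpen_singleton_iff_punctured_nhds _).2 hbot
  have h0 : IsOpen ({0} : Set ({i : Fin n // c i = false} × {j : Fin n // c j = true} → F)) := by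
    have : Φ ⁻¹' {1} = {0} := by
      ext x
      rw [Set.mem_preimage, Set.mem_singleton_iff, Set.mem_singleton_iff, ← hΦ0, Φ.injective.eq_iff]
    rw [← this]
    exact h1.preimage Φ.continuous
  have hι : Continuous fun t : F => (Pi.single (⟨i₀, hi₀⟩, ⟨j₀, hj₀⟩) t : {i : Fin n // c i = false} × {j : Fin n // c j = true} → F) :=
    continuous_pi fun p => by
      by_cases hp : p = (⟨i₀, hi₀⟩, ⟨j₀, hj₀⟩)
      · subst hp; simp only [Pi.single_eq_same]; exact continuous_id
      · simp only [Pi.single_eq_of_ne hp]; exact continuous_const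
  have h0F : IsOpen ({0} : Set F) := by
    have : (fun t : F => (Pi.single (⟨i₀, hi₀⟩, ⟨j₀, hj₀⟩) t : {i : Fin n // c i = false} × {j : Fin n // c j = true} → F)) ⁻¹' {0} = {0} := by
      ext t
      rw [Set.mem_preimage, Set.mem_singleton_iff, Set.mem_singleton_iff, Pi.single_eq_zero_iff]
    rw [← this]
    exact h0.preimage hι
  exact discreteTopology_of_isOpen_singleton_zero h0F

variable [MeasurableSpace (GL (Fin n) F)] [BorelSpace (GL (Fin n) F)]

/-- **`μ_U {1} = 0`** for a Haar measure on `U_c(F)` with non-empty box (no atoms on a non-discrete locally compact group). [cite: BernsteinZelevinsky1977, §2.1] -/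
theorem haar_unipotentRadicalGL_singleton_one (hIJ : ∃ i j : Fin n, c i = false ∧ c j = true)
    (μN : Measure ↥(unipotentRadicalGL F c)) [IsHaarMeasure μN] : μN {1} = 0 := by
  classical
  haveI : T2Space F := (isLocalField F).toT2Space
  haveI : LocallyCompactSpace F := (isLocalField F).toLocallyCompactSpace
  haveI : T2Space (GL (Fin n) F) := t2Space_generalLinearGroup F n
  obtain ⟨Φ, -, -⟩ := exists_boxHomeomorph_unipotentRadicalGL (R := F) c
  haveI : LocallyCompactSpace ↥(unipotentRadicalGL F c) := Φ.symm.isClosedEmbedding.locallyCompactSpace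
  haveI := nhdsWithin_ne_one_neBot_unipotentRadicalGL (F := F) hIJ
  haveI : IsTopologicalGroup ↥(unipotentRadicalGL F c) := inferInstance
  exact measure_singleton (1 : ↥(unipotentRadicalGL F c))

omit [BorelSpace (GL (Fin n) F)] in
/-- A Haar measure on `U_c(F)` is s-finite (`U_c ≅ F^{I×J}` is locally compact and second countable). [folklore] -/
theorem sFinite_haar_unipotentRadicalGL (μN : Measure ↥(unipotentRadicalGL F c)) [IsHaarMeasure μN] : SFinite μN := by
  classical
  haveI : T2Space F := (isLocalField F).toT2Space
  haveI : SecondCountableTopology F := secondCountableTopology_localField F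
  haveI : LocallyCompactSpace F := (isLocalField F).toLocallyCompactSpace
  obtain ⟨Φ, -, -⟩ := exists_boxHomeomorph_unipotentRadicalGL (R := F) c
  haveI := Φ.symm.isClosedEmbedding.locallyCompactSpace
  haveI := Φ.symm.secondCountableTopology
  infer_instance

omit [ValuativeRel F] [IsNonarchimedeanLocalField F] [MeasurableSpace (GL (Fin n) F)] [BorelSpace (GL (Fin n) F)] in
/-- `(Ad x)⁻¹(U)` is compact for compact `U ⊆ 𝔤𝔩_n(F)` (it is closed and contained in `Ad(x⁻¹) U`). [folklore] -/
theorem isCompact_preimage_conj [IsTopologicalRing F] [T2Space F] (x : GL (Fin n) F) {U : Set (Matrix (Fin n) (Fin n) F)} (hU : IsCompact U) :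
    IsCompact ((fun Y : Matrix (Fin n) (Fin n) F => (x : Matrix (Fin n) (Fin n) F) * Y * ((x⁻¹ : GL (Fin n) F) : Matrix (Fin n) (Fin n) F)) ⁻¹' U) := by
  have hc : Continuous fun Y : Matrix (Fin n) (Fin n) F => (x : Matrix (Fin n) (Fin n) F) * Y * ((x⁻¹ : GL (Fin n) F) : Matrix (Fin n) (Fin n) F) :=
    (continuous_const.mul continuous_id).mul continuous_const
  have hc' : Continuous fun Y : Matrix (Fin n) (Fin n) F => ((x⁻¹ : GL (Fin n) F) : Matrix (Fin n) (Fin n) F) * Y * (x : Matrix (Fin n) (Fin n) F) :=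
    (continuous_const.mul continuous_id).mul continuous_const
  refine (hU.image hc').of_isClosed_subset (hU.isClosed.preimage hc) fun Y hY => ⟨_, hY, ?_⟩
  show ((x⁻¹ : GL (Fin n) F) : Matrix (Fin n) (Fin n) F) * ((x : Matrix (Fin n) (Fin n) F) * Y * ((x⁻¹ : GL (Fin n) F) : Matrix (Fin n) (Fin n) F)) *
      (x : Matrix (Fin n) (Fin n) F) = Y
  rw [← Matrix.mul_assoc, ← Matrix.mul_assoc, Units.inv_mul, Matrix.one_mul, Matrix.mul_assoc, Units.inv_mul, Matrix.mul_one]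

variable [MeasurableSpace (Matrix (Fin n) (Fin n) F)] [BorelSpace (Matrix (Fin n) (Fin n) F)]
  (κ : Measure ↥(glInt n F)) (μN : Measure ↥(unipotentRadicalGL F c))

/-- The Richardson map is measurable (continuous; `GL_n(F)` second countable). [folklore] -/
theorem measurable_richardsonMap :
    Measurable fun q : ↥(glInt n F) × ↥(unipotentRadicalGL F c) =>
      (((q.1 : GL (Fin n) F)) : Matrix (Fin n) (Fin n) F) * ((((q.2 : GL (Fin n) F)) : Matrix (Fin n) (Fin n) F) - 1) *
        ((((q.1 : GL (Fin n) F))⁻¹ : GL (Fin n) F) : Matrix (Fin n) (Fin n) F) := by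
  haveI : T2Space F := (isLocalField F).toT2Space
  haveI : SecondCountableTopology (GL (Fin n) F) := Literature.NumberTheory.Weil1964.secondCountableTopology_generalLinearGroup F n
  exact (continuous_richardsonMap (F := F) (c := c)).measurable

/-- **`Λ_c` IS FINITE ON COMPACT SETS**: `φ⁻¹(C) ⊆ GL_n(𝒪) × Φ(L(Ad(GL_n(𝒪))⁻¹·C))`, with `Φ` the box chart of `U_c` (★) and `L` the entry-reading map, both sets on
the right compact. [cite: HarishChandra1999AdmissibleDistributions, §3 p. 9] -/
theorem isFiniteMeasureOnCompacts_map_richardson [IsFiniteMeasure κ] [IsFiniteMeasureOnCompacts μN] [SFinite μN] :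
    IsFiniteMeasureOnCompacts ((κ.prod μN).map fun q : ↥(glInt n F) × ↥(unipotentRadicalGL F c) =>
      (((q.1 : GL (Fin n) F)) : Matrix (Fin n) (Fin n) F) * ((((q.2 : GL (Fin n) F)) : Matrix (Fin n) (Fin n) F) - 1) *
        ((((q.1 : GL (Fin n) F))⁻¹ : GL (Fin n) F) : Matrix (Fin n) (Fin n) F)) := by
  classical
  haveI : T2Space F := (isLocalField F).toT2Space
  haveI : CompactSpace ↥(glInt n F) := isCompact_iff_compactSpace.1 (isCompact_glInt n F)
  obtain ⟨Φ, hΦ, -⟩ := exists_boxHomeomorph_unipotentRadicalGL (R := F) c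
  refine ⟨fun C hC => ?_⟩
  rw [Measure.map_apply (measurable_richardsonMap (F := F) (c := c)) hC.measurableSet]
  -- `S = Ad(K)⁻¹ · C`, compact
  set S : Set (Matrix (Fin n) (Fin n) F) := (fun p : ↥(glInt n F) × Matrix (Fin n) (Fin n) F =>
    ((((p.1 : GL (Fin n) F))⁻¹ : GL (Fin n) F) : Matrix (Fin n) (Fin n) F) * p.2 * (((p.1 : GL (Fin n) F)) : Matrix (Fin n) (Fin n) F)) '' (Set.univ ×ˢ C)
    with hS
  have hSc : IsCompact S := (isCompact_univ.prod hC).image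
    (((Units.continuous_coe_inv.comp (continuous_subtype_val.comp continuous_fst)).mul continuous_snd).mul
      (Units.continuous_val.comp (continuous_subtype_val.comp continuous_fst)))
  -- the entry-reading map `L` and the compact `T = Φ(L(S)) ⊆ U_c`
  set L : Matrix (Fin n) (Fin n) F → ({i : Fin n // c i = false} × {j : Fin n // c j = true} → F) := fun Y p => Y p.1.1 p.2.1 with hL
  have hLc : Continuous L := continuous_pi fun p => (continuous_apply p.2.1).comp (continuous_apply p.1.1)
  have hT : IsCompact (Φ '' (L '' S)) := (hSc.image hLc).image Φ.continuous
  have hLΦ : ∀ x, L ((((Φ x : GL (Fin n) F)) : Matrix (Fin n) (Fin n) F) - 1) = x := fun x => by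
    funext p
    simp only [hL, Matrix.sub_apply, hΦ, Matrix.one_apply]
    have hne : (p.1 : Fin n) ≠ (p.2 : Fin n) := fun h => by
      have h1 := p.1.2; have h2 := p.2.2; rw [h] at h1; rw [h1] at h2; exact Bool.false_ne_true h2
    rw [if_neg hne, dif_pos ⟨p.1.2, p.2.2⟩]
    simp
  have hsub : (fun q : ↥(glInt n F) × ↥(unipotentRadicalGL F c) =>
      (((q.1 : GL (Fin n) F)) : Matrix (Fin n) (Fin n) F) * ((((q.2 : GL (Fin n) F)) : Matrix (Fin n) (Fin n) F) - 1) *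
        ((((q.1 : GL (Fin n) F))⁻¹ : GL (Fin n) F) : Matrix (Fin n) (Fin n) F)) ⁻¹' C ⊆ Set.univ ×ˢ (Φ '' (L '' S)) := by
    rintro ⟨k, u⟩ hq
    refine ⟨Set.mem_univ _, ?_⟩
    have hmem : (((u : GL (Fin n) F)) : Matrix (Fin n) (Fin n) F) - 1 ∈ S := by
      refine ⟨(k, _), ⟨Set.mem_univ _, hq⟩, ?_⟩
      simp only
      rw [← Matrix.mul_assoc, ← Matrix.mul_assoc, Units.inv_mul, Matrix.one_mul, Matrix.mul_assoc, Units.inv_mul, Matrix.mul_one]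
    refine ⟨Φ.symm u, ⟨_, hmem, ?_⟩, Φ.apply_symm_apply u⟩
    rw [← hLΦ (Φ.symm u), Φ.apply_symm_apply]
  calc (κ.prod μN) _ ≤ (κ.prod μN) (Set.univ ×ˢ (Φ '' (L '' S))) := measure_mono hsub
    _ = κ Set.univ * μN (Φ '' (L '' S)) := Measure.prod_prod _ _
    _ < ⊤ := ENNReal.mul_lt_top (measure_lt_top κ _) hT.measure_lt_top

/-- **`Λ_c ≠ 0`** (`Λ_c(𝔤𝔩_n) = κ(GL_n(𝒪)) · μ_U(U_c) > 0`). [cite: HarishChandra1999AdmissibleDistributions, §3 p. 9] -/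
theorem map_richardson_ne_zero [IsHaarMeasure κ] [IsHaarMeasure μN] :
    ((κ.prod μN).map fun q : ↥(glInt n F) × ↥(unipotentRadicalGL F c) =>
      (((q.1 : GL (Fin n) F)) : Matrix (Fin n) (Fin n) F) * ((((q.2 : GL (Fin n) F)) : Matrix (Fin n) (Fin n) F) - 1) *
        ((((q.1 : GL (Fin n) F))⁻¹ : GL (Fin n) F) : Matrix (Fin n) (Fin n) F)) ≠ 0 := by
  haveI := sFinite_haar_unipotentRadicalGL (F := F) μN
  intro h
  have h1 := congrArg (fun m : Measure (Matrix (Fin n) (Fin n) F) => m Set.univ) h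
  simp only [Measure.map_apply (measurable_richardsonMap (F := F) (c := c)) MeasurableSet.univ, Set.preimage_univ, Measure.coe_zero, Pi.zero_apply] at h1
  rw [← Set.univ_prod_univ, Measure.prod_prod] at h1
  exact mul_ne_zero (isOpen_univ.measure_pos κ ⟨1, Set.mem_univ _⟩).ne' (isOpen_univ.measure_pos μN ⟨1, Set.mem_univ _⟩).ne' h1

/-- **`Λ_c` IS `Ad(GL_n(F))`-INVARIANT AS A MEASURE**: `Ad(x)_* Λ_c = Λ_c` for every `x ∈ GL_n(F)` (monotone two-block `c`, Haar `κ`, `μ_U`).  ★ p857353 gives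
`∫ 1_U(x φ(q) x⁻¹) dρ = ∫ 1_U(φ(q)) dρ` for every compact-open `U` (its indicator is a test function), i.e. the two measures agree on compact opens; §1 concludes.
[cite: HarishChandra1999AdmissibleDistributions, §3 p. 9, Thm. 4.4 p. 11] [cite: BernsteinZelevinsky1976, §1.18] -/
theorem map_conj_map_richardson_eq [MeasurableSpace F] [BorelSpace F] (hc : Monotone c) [IsHaarMeasure κ] [IsHaarMeasure μN] (x : GL (Fin n) F) :
    (((κ.prod μN).map fun q : ↥(glInt n F) × ↥(unipotentRadicalGL F c) =>
      (((q.1 : GL (Fin n) F)) : Matrix (Fin n) (Fin n) F) * ((((q.2 : GL (Fin n) F)) : Matrix (Fin n) (Fin n) F) - 1) *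
        ((((q.1 : GL (Fin n) F))⁻¹ : GL (Fin n) F) : Matrix (Fin n) (Fin n) F)).map
      fun Y : Matrix (Fin n) (Fin n) F => (x : Matrix (Fin n) (Fin n) F) * Y * ((x⁻¹ : GL (Fin n) F) : Matrix (Fin n) (Fin n) F)) =
    (κ.prod μN).map fun q : ↥(glInt n F) × ↥(unipotentRadicalGL F c) =>
      (((q.1 : GL (Fin n) F)) : Matrix (Fin n) (Fin n) F) * ((((q.2 : GL (Fin n) F)) : Matrix (Fin n) (Fin n) F) - 1) *
        ((((q.1 : GL (Fin n) F))⁻¹ : GL (Fin n) F) : Matrix (Fin n) (Fin n) F) := by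
  classical
  haveI : T2Space F := (isLocalField F).toT2Space
  haveI : LocallyCompactSpace F := (isLocalField F).toLocallyCompactSpace
  haveI : SecondCountableTopology F := secondCountableTopology_localField F
  haveI : TotallyDisconnectedSpace F := totallyDisconnectedSpace_of_isNonarchimedeanLocalField F
  haveI : LocallyCompactSpace (Matrix (Fin n) (Fin n) F) := Pi.locallyCompactSpace_of_finite
  haveI : SecondCountableTopology (Matrix (Fin n) (Fin n) F) := inferInstanceAs (SecondCountableTopology (Fin n → Fin n → F))
  haveI : TotallyDisconnectedSpace (Matrix (Fin n) (Fin n) F) := inferInstanceAs (TotallyDisconnectedSpace (Fin n → Fin n → F))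
  haveI : CompactSpace ↥(glInt n F) := isCompact_iff_compactSpace.1 (isCompact_glInt n F)
  haveI := sFinite_haar_unipotentRadicalGL (F := F) μN
  haveI := isFiniteMeasureOnCompacts_map_richardson (F := F) (c := c) κ μN
  have hφ := measurable_richardsonMap (F := F) (c := c)
  have hAdc : Continuous fun Y : Matrix (Fin n) (Fin n) F => (x : Matrix (Fin n) (Fin n) F) * Y * ((x⁻¹ : GL (Fin n) F) : Matrix (Fin n) (Fin n) F) :=
    (continuous_const.mul continuous_id).mul continuous_const
  have hAd : Measurable fun Y : Matrix (Fin n) (Fin n) F => (x : Matrix (Fin n) (Fin n) F) * Y * ((x⁻¹ : GL (Fin n) F) : Matrix (Fin n) (Fin n) F) := hAdc.measurable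
  symm
  refine Measure.ext_of_forall_isCompact_isOpen fun U hUc hUo => ?_
  rw [Measure.map_apply hAd hUo.measurableSet, Measure.map_apply hφ hUo.measurableSet, Measure.map_apply hφ (hAd hUo.measurableSet)]
  -- ★ p857353 on the test function `1_U`
  have key := GLn.nilpotentAverage_comp_conj_eq hc κ μN (isLocSmooth_indicator hUo hUc.isClosed hUc) x
  have hL : (fun q : ↥(glInt n F) × ↥(unipotentRadicalGL F c) => U.indicator (fun _ => (1 : ℂ))
      ((x : Matrix (Fin n) (Fin n) F) * ((((q.1 : GL (Fin n) F)) : Matrix (Fin n) (Fin n) F) * ((((q.2 : GL (Fin n) F)) : Matrix (Fin n) (Fin n) F) - 1) *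
        ((((q.1 : GL (Fin n) F))⁻¹ : GL (Fin n) F) : Matrix (Fin n) (Fin n) F)) * ((x⁻¹ : GL (Fin n) F) : Matrix (Fin n) (Fin n) F))) =
      ((fun q : ↥(glInt n F) × ↥(unipotentRadicalGL F c) =>
        (((q.1 : GL (Fin n) F)) : Matrix (Fin n) (Fin n) F) * ((((q.2 : GL (Fin n) F)) : Matrix (Fin n) (Fin n) F) - 1) *
          ((((q.1 : GL (Fin n) F))⁻¹ : GL (Fin n) F) : Matrix (Fin n) (Fin n) F)) ⁻¹'
        ((fun Y : Matrix (Fin n) (Fin n) F => (x : Matrix (Fin n) (Fin n) F) * Y * ((x⁻¹ : GL (Fin n) F) : Matrix (Fin n) (Fin n) F)) ⁻¹' U)).indicator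
        fun _ => (1 : ℂ) := by
    funext q
    simp only [Set.indicator_apply, Set.mem_preimage]
  have hR : (fun q : ↥(glInt n F) × ↥(unipotentRadicalGL F c) => U.indicator (fun _ => (1 : ℂ))
      ((((q.1 : GL (Fin n) F)) : Matrix (Fin n) (Fin n) F) * ((((q.2 : GL (Fin n) F)) : Matrix (Fin n) (Fin n) F) - 1) *
        ((((q.1 : GL (Fin n) F))⁻¹ : GL (Fin n) F) : Matrix (Fin n) (Fin n) F))) =
      ((fun q : ↥(glInt n F) × ↥(unipotentRadicalGL F c) =>
        (((q.1 : GL (Fin n) F)) : Matrix (Fin n) (Fin n) F) * ((((q.2 : GL (Fin n) F)) : Matrix (Fin n) (Fin n) F) - 1) *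
          ((((q.1 : GL (Fin n) F))⁻¹ : GL (Fin n) F) : Matrix (Fin n) (Fin n) F)) ⁻¹' U).indicator fun _ => (1 : ℂ) := by
    funext q
    simp only [Set.indicator_apply, Set.mem_preimage]
  rw [hL, hR, integral_indicator_const _ (hφ (hAd hUo.measurableSet)), integral_indicator_const _ (hφ hUo.measurableSet)] at key
  have hfin₁ : (κ.prod μN) ((fun q : ↥(glInt n F) × ↥(unipotentRadicalGL F c) =>
      (((q.1 : GL (Fin n) F)) : Matrix (Fin n) (Fin n) F) * ((((q.2 : GL (Fin n) F)) : Matrix (Fin n) (Fin n) F) - 1) *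
        ((((q.1 : GL (Fin n) F))⁻¹ : GL (Fin n) F) : Matrix (Fin n) (Fin n) F)) ⁻¹'
      ((fun Y : Matrix (Fin n) (Fin n) F => (x : Matrix (Fin n) (Fin n) F) * Y * ((x⁻¹ : GL (Fin n) F) : Matrix (Fin n) (Fin n) F)) ⁻¹' U)) ≠ ⊤ := by
    rw [← Measure.map_apply hφ (hAd hUo.measurableSet)]
    exact ((isCompact_preimage_conj x hUc).measure_lt_top).ne
  have hfin₂ : (κ.prod μN) ((fun q : ↥(glInt n F) × ↥(unipotentRadicalGL F c) =>
      (((q.1 : GL (Fin n) F)) : Matrix (Fin n) (Fin n) F) * ((((q.2 : GL (Fin n) F)) : Matrix (Fin n) (Fin n) F) - 1) *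
        ((((q.1 : GL (Fin n) F))⁻¹ : GL (Fin n) F) : Matrix (Fin n) (Fin n) F)) ⁻¹' U) ≠ ⊤ := by
    rw [← Measure.map_apply hφ hUo.measurableSet]
    exact (hUc.measure_lt_top).ne
  have hreal := congrArg Complex.re key
  simp only [Complex.real_smul, mul_one, Complex.ofReal_re, measureReal_def] at hreal
  exact ((ENNReal.toReal_eq_toReal_iff' hfin₁ hfin₂).1 hreal).symm

end General

end Summit.HodgeConjecture.HodgeConjecture.Cruxes.H413.K2E3GLnRichardsonMeasureRadon

end
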